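import Summits.ResolutionOfSingularities.ResolutionOfSingularities.Theorems.WeightedInvariantELadderTwoOverCentre
import Summits.ResolutionOfSingularities.ResolutionOfSingularities.Theorems.WeightedInvariantELadderTwoCompatible
import HarnessLib

/-!
# E2 tier, (o59-loc) OVER-CENTRE branch at the STAGE level: `ι_{η'} < ι_{π η'} = mu₂` at a successor read point over the maximum locus

[OURS · L1 W4.3 · door `HypersurfaceCentreConstruction` (stmt-ResolutionOfSingularities-19897) · E2 tier · the stage-level reading of the registrar's
(o58e) ring lemma (`E2OverCentre.iota_lt_of_overCentre_model`, p548577) through `Stage.SuccOverCentreAt` / `Stage.SuccCompatible`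
(…ELadderTwoCompatible, p546537) and `Stage.IsCanonicalCentre₂.stalkIdeal_eq` (…ELadderTwoStage); typed by res-D-pv-056 AS res-L1-w43-stub-5
(registrar res-L1-w43-plan-1 ORDERs (o58d)/(o58e) 2026-08-27T16:23–16:24Z, the over-branch script of E2-CENSUS v0 §6).  Def-free; the
k₀-algebra / essentially-finite-type / regular-local-ring structure and the dimension bound of the stalk `𝒪_{Y, π η′}` (U6), `f_y ≠ 0`,
`f_y ∈ 𝔪_y²` and `f'_{η'} ∈ 𝔪_{η'}²` are HYPOTHESES (nothing geometric is proved here); `--supports stmt-ResolutionOfSingularities-19897 --as helper`.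
Not a statement of [Hironaka2017]; candidates only.]

* `Stage.iotaAt_lt_of_succOverCentreAt` — (c6) + (c-u) + `CanonicalGameClauseHomLE 3 p ι J` + canonical `e = 2` centre `R` + `π η' ∈ maxLocus₂`
  + `S.SuccOverCentreAt R S' π η'` ⇒ `iotaAt ι S'.i.ker η' < iotaAt ι S.i.ker (π η')` (the presentations of `J(𝒪_y, f_y)` are the
  presentations of the stalk filtration of `R` at `y` by `IsCanonicalCentre₂.stalkIdeal_eq`, so the ring lemma's over-model premise is
  `SuccOverCentreAt` minus its stalk-map conjunct).
* `Stage.iotaAt_lt_mu₂_of_succOverCentreAt` — the same, concluded as `< S.mu₂ ι` (`mem_maxLocus₂_iff`).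
* `Stage.iotaAt_lt_mu₂_of_succCompatible_overCentre` — for a COMPATIBLE successor, at a read point `η' ∈ genSing₂'` OVER `supp R`.
Together with `Stage.iotaAt_lt_mu₂_of_succCompatible_offCentre` (…ELadderTwoOffCentre rev 2) this gives `ι_{η'} < mu₂` at EVERY read point of a
compatible successor, pointwise; the remaining step of `E2InvSuccLocBody` is the supremum (`mu₂' < mu₂`: attainment / finiteness on `genSing₂'`).
-/

noncomputable section

open CategoryTheory AlgebraicGeometry TopologicalSpace IsLocalRing
open Literature.AlgebraicGeometry.Resolution
open Summit.ResolutionOfSingularities.ResolutionOfSingularities.Theorems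
open Summit.ResolutionOfSingularities.ResolutionOfSingularities.Cruxes.HypersurfaceCentreConstruction.LocalEngine

set_option linter.dupNamespace false -- mandated namespace of this single-conjunct summit

namespace Summit.ResolutionOfSingularities.ResolutionOfSingularities.Theorems.ELadderOne.Stage

variable {k : Type} [Field k]

/-- **OVER-CENTRE DROP AT THE STAGE LEVEL.**  Under (c6), (c-u) and `CanonicalGameClauseHomLE 3 p ι J`: for a canonical `e = 2` centre `R`, a
successor point `η'` over a point `π η'` of the maximum locus with the cobordant local model (`S.SuccOverCentreAt R S' π η'`), the stalk
`𝒪_{Y, π η'}` a regular local `k₀`-algebra essentially of finite type of Krull dimension `≤ 3` (`k₀` perfect of characteristic `p`), `f_{π η'} ≠ 0`,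
`f_{π η'} ∈ 𝔪²` and `f'_{η'} ∈ 𝔪_{η'}²`: `ι_{η'} < ι_{π η'}`. [folklore] -/
theorem iotaAt_lt_of_succOverCentreAt {p : ℕ} (ι : (R : Type) → [CommRing R] → R → Ordinal.{0})
    (J : (R : Type) → [CommRing R] → R → ℕ → Ideal R)
    (hiso : IotaIsoInvariant ι) (hunit : IotaUnitInvariant ι) (hgame : CanonicalGameClauseHomLE 3 p ι J)
    (k₀ : Type) [Field k₀] [CharP k₀ p] [PerfectField k₀]
    (S S' : Stage k) {R : ReesAlgebraData S.Y} (π : S'.Y ⟶ S.Y) (hR : S.IsCanonicalCentre₂ ι J R) (η' : S'.Y)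
    [Algebra k₀ (S.Y.presheaf.stalk (π.base η'))] [Algebra.EssFiniteType k₀ (S.Y.presheaf.stalk (π.base η'))]
    [IsRegularLocalRing (S.Y.presheaf.stalk (π.base η'))]
    (hdim : ringKrullDim (S.Y.presheaf.stalk (π.base η')) ≤ 3) (hy : π.base η' ∈ S.maxLocus₂ ι)
    (hf0 : localGenerator S.i.ker (π.base η') ≠ 0)
    (hf2 : localGenerator S.i.ker (π.base η') ∈ (maximalIdeal (S.Y.presheaf.stalk (π.base η'))) ^ 2)
    (hg' : localGenerator S'.i.ker η' ∈ (maximalIdeal (S'.Y.presheaf.stalk η')) ^ 2)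
    (h : S.SuccOverCentreAt R S' π η') :
    iotaAt ι S'.i.ker η' < iotaAt ι S.i.ker (π.base η') := by
  refine E2OverCentre.iota_lt_of_overCentre_model hiso hunit hgame k₀ hdim _ hf0 hf2 hg' ?_
  intro n u w hJ
  have hJ' : ∀ m : ℕ, weightedMonomialIdeal u w m = stalkIdeal (R.piece m) (π.base η') := fun m => by
    rw [hJ m, hR.stalkIdeal_eq _ hy m]
  obtain ⟨𝔫, h𝔫, hT, ht, hm, hv, e, -, a, g, hfac, hndvd, hassoc⟩ := h n u w hJ'
  exact ⟨𝔫, h𝔫, hT, ht, hm, hv, e, a, g, hfac, hndvd, hassoc⟩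

/-- … concluded against the termination measure: `ι_{η'} < mu₂` (`ι_{π η'} = mu₂` on the maximum locus). [folklore] -/
theorem iotaAt_lt_mu₂_of_succOverCentreAt {p : ℕ} (ι : (R : Type) → [CommRing R] → R → Ordinal.{0})
    (J : (R : Type) → [CommRing R] → R → ℕ → Ideal R)
    (hiso : IotaIsoInvariant ι) (hunit : IotaUnitInvariant ι) (hgame : CanonicalGameClauseHomLE 3 p ι J)
    (k₀ : Type) [Field k₀] [CharP k₀ p] [PerfectField k₀]
    (S S' : Stage k) {R : ReesAlgebraData S.Y} (π : S'.Y ⟶ S.Y) (hR : S.IsCanonicalCentre₂ ι J R) (η' : S'.Y)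
    [Algebra k₀ (S.Y.presheaf.stalk (π.base η'))] [Algebra.EssFiniteType k₀ (S.Y.presheaf.stalk (π.base η'))]
    [IsRegularLocalRing (S.Y.presheaf.stalk (π.base η'))]
    (hdim : ringKrullDim (S.Y.presheaf.stalk (π.base η')) ≤ 3) (hy : π.base η' ∈ S.maxLocus₂ ι)
    (hf0 : localGenerator S.i.ker (π.base η') ≠ 0)
    (hf2 : localGenerator S.i.ker (π.base η') ∈ (maximalIdeal (S.Y.presheaf.stalk (π.base η'))) ^ 2)
    (hg' : localGenerator S'.i.ker η' ∈ (maximalIdeal (S'.Y.presheaf.stalk η')) ^ 2)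
    (h : S.SuccOverCentreAt R S' π η') :
    iotaAt ι S'.i.ker η' < S.mu₂ ι := by
  have hlt := iotaAt_lt_of_succOverCentreAt ι J hiso hunit hgame k₀ S S' π hR η' hdim hy hf0 hf2 hg' h
  rwa [((S.mem_maxLocus₂_iff ι (π.base η')).mp hy).2] at hlt

/-- **OVER-CENTRE, assembled for a COMPATIBLE successor:** `S.SuccCompatible ι R S' π`, a read point `η' ∈ genSing₂'` OVER `supp R`, the stalk
hypotheses at `π η'` and the three order conditions on the local equations ⇒ `ι_{η'} < mu₂`. [folklore] -/
theorem iotaAt_lt_mu₂_of_succCompatible_overCentre {p : ℕ} (ι : (R : Type) → [CommRing R] → R → Ordinal.{0})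
    (J : (R : Type) → [CommRing R] → R → ℕ → Ideal R)
    (hiso : IotaIsoInvariant ι) (hunit : IotaUnitInvariant ι) (hgame : CanonicalGameClauseHomLE 3 p ι J)
    (k₀ : Type) [Field k₀] [CharP k₀ p] [PerfectField k₀]
    (S S' : Stage k) {R : ReesAlgebraData S.Y} (π : S'.Y ⟶ S.Y) (hR : S.IsCanonicalCentre₂ ι J R) (hc : S.SuccCompatible ι R S' π)
    (η' : S'.Y) [Algebra k₀ (S.Y.presheaf.stalk (π.base η'))] [Algebra.EssFiniteType k₀ (S.Y.presheaf.stalk (π.base η'))]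
    [IsRegularLocalRing (S.Y.presheaf.stalk (π.base η'))]
    (hdim : ringKrullDim (S.Y.presheaf.stalk (π.base η')) ≤ 3) (hη' : η' ∈ S'.genSing₂) (hsupp : π.base η' ∈ R.support)
    (hf0 : localGenerator S.i.ker (π.base η') ≠ 0)
    (hf2 : localGenerator S.i.ker (π.base η') ∈ (maximalIdeal (S.Y.presheaf.stalk (π.base η'))) ^ 2)
    (hg' : localGenerator S'.i.ker η' ∈ (maximalIdeal (S'.Y.presheaf.stalk η')) ^ 2) :
    iotaAt ι S'.i.ker η' < S.mu₂ ι := by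
  obtain ⟨hy, hover⟩ := hc.overCentre η' hη' hsupp
  exact iotaAt_lt_mu₂_of_succOverCentreAt ι J hiso hunit hgame k₀ S S' π hR η' hdim hy hf0 hf2 hg' hover

end Summit.ResolutionOfSingularities.ResolutionOfSingularities.Theorems.ELadderOne.Stage

end
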